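import Summits.QuantumFields.BalabanUV.Beta.D1BFx.RoadEndBFxSpineDictS

/-!
# Road «BF-x» — the (K) dictionary row `hdict` IN POINTWISE CURRENCY («DICT-PTW»)

`RoadEndBFxSpineDictS` (p305244) displays the road's ONE remaining load-bearing analytic row about Bałaban's kernels as a statement about
(1.22) SECOND MOMENTS: `hdict : ∀ m ≥ 1, |M₂[TshotOf Lc Jc m]_{μν} − (ω_gl·M₂[TOfRed …] + ω_gh·M₂[PghQ …] + Σ_u Ru u)(Lc^m)| ≤ U₁`.
Every dictionary brick in the tree, and in particular the (A1) identity `KCombineCovStripped.hessKer_transfer_road_cov_stripped`, is an identity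
of KERNELS, POINTWISE in the separation `z`.  This file moves the (K) row into that currency once and for all:

* §1 (generic, channel level) `secondMoment_of_pointwise`: if `T μ ν z = ωA·A μ ν z + ωB·B μ ν z + Σ_u R u μ ν z` for every `z` and the channels of
  `A`, `B`, `R u` have absolutely summable second moments (`AbsMoment₂`), then `M₂[T] = ωA·M₂[A] + ωB·M₂[B] + Σ_u M₂[R u]` (termwise `tsum`
  algebra, `ScalewiseWitness.summable_secondMoment_term`); `abs_secondMoment_sub_le_of_pointwise`: with read-out slack `|M₂[R u] − Ru u| ≤ CU′ u`
  the `hdict`-shaped inequality holds with `Σ_u CU′ u`.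
* §2 `hdict_of_pointwise`: THE ROAD's `hdict` ROW from (i) rest-word KERNELS `Rk u n` and the POINTWISE dictionary
  `hptw : ∀ m ≥ 1, ∀ z, TshotOf Lc Jc m μ ν z = ω_gl n·TOfRed n a (SbfBal …) (tableRed n (Wbf …)) μ ν z + ω_gh n·PghQ n a x₀ cK cQ μ ν z + Σ_u Rk u n μ ν z`
  (`n = Lc^m`), (ii) `AbsMoment₂` of the rest kernels' channel, (iii) the read-out slack rows `|M₂[Rk u n] − Ru u n| ≤ CU′ u`, `Σ_u CU′ u ≤ U₁` —
  the `AbsMoment₂` of the gluon term is DISCHARGED inside from `h12`∕`h126` (`GluonLegTails.hGa_of_prop12` ⇒ `Spr (Ga n a)`), the binder-free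
  vertex family of `SbfBal` (`FineStencilBFBalaban.exists_vertexFamily_vertexRed_SbfBal`) and the END's own slot-table sockets `hE hJ hΛ hR hQ`
  (`SecondStencilBF.biLoc_Wbf` ⇒ `ReducedTableBridge.vertexFamily₂_tableRed'` ⇒ `ReducedKernel.absMoment₂_TOfRed`); that of the ghost term is
  `GhostKernelComplete.absMoment₂_PghQ` (`0 < a` only).
* §3 `d1Rep_BFx_of_D1Tel_ptw_sbpS`: the junction END `RoadEndBFxSpineDictS.d1Rep_BFx_of_D1Tel_dict_sbpS` (road BF-x ⟹ the spine root's `D1Rep` at the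
  root's own binder names `hW`∕`hRfl`∕`htel`) with the row `hdict` REPLACED by the pointwise rows of §2; every other binder BYTE-IDENTICAL.

READING.  After this file the road's (K) debt is displayed in the currency in which (A1)–(A3) are being proved: ONE pointwise kernel identity per
one-shot scale `n = Lc^m` (`hptw`) — «Bałaban's one-shot resolvent Hessian kernel with the composite jets `Jc m` IS, entry by entry, the Feynman-gauge
gluon kernel over `Ga` with the road's stencils + the complete ghost kernel + finitely many rest-word kernels» — plus unit-class moment rows on the
rest kernels.  HONEST: [folklore] `tsum` bookkeeping and composition BY NAME; `hptw`, `hMR`, `hRu`, the spine's `hW`∕`hRfl`∕`htel` and every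
socket∕pin∕table row are HYPOTHESES; 0 rows discharged; (K) NOT closed; NOT D1, NOT `BetaPertH`, NOT continuum, NOT Clay.
HONEST DEPENDENCY: continuum YM on T⁴ ⇐ BetaPertH ∧ nine spine estimates (0/9 proved); BetaPertH ⇐ (D1) ∧ (D4) ∧ CAP+tail; G-an2-4 gates asym, D1 and NE2/3/4.
-/

noncomputable section

open Finset Filter Topology
open Literature.Probability.LatticeModels (annulus)
open scoped BigOperators
open Literature.MathematicalPhysics.QuantumFieldTheory.Balaban1983to89
open Literature.MathematicalPhysics.QuantumFieldTheory.Balaban1983to89.Beta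
open OneStepResolventKernel (JetData KInv)
open OneStepKernelFamily (TbalOf TshotOf flipK D1Tel D1Rep D1Drift)
open PolarizationSign (WardTransversal AxisReflectionCovariant)
open StepDriftWitness (D1Sum d1Sum_iff d1Sum_of_d1Tel d1Rep_iff_d1Drift_of_d1Sum)
open InterLevelTransport (onLat)
open BalabanStepJets (lamCoeffOf)
open AveragingHessianKernels (hessFF)
open KernelWard (divV)
open WindowIdentification (fullSum psum)
open B12Sec2to5 (l1)
open DyadicShell (Pt toReal supNorm)
open ExpKernelCalculus (Site MKer BiLoc shiftK comp VertexFamily VertexFamily₂)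
open DecimatedMomentSummable (AbsMoment₂)
open DecimatedMomentSummable (IsMoment₂ summable_smul_of_absMoment₂)
open GhostTable (gFree)
open BubbleTransfer (unitVec)
open DressedMomentNormalisation (resSite)
open PoissonInterior (nrm)
open Summit.QuantumFields.BalabanUV.Beta.TameKernelCalculus (Spr Loc trK)
open Summit.QuantumFields.BalabanUV.Beta.D1BFx.ReducedKernel (TableR TOfRed vertexRed absMoment₂_TOfRed)
open Summit.QuantumFields.BalabanUV.Beta.D1BFx.DressedTadpoleTable (tableRed tadpoleTable)
open Summit.QuantumFields.BalabanUV.Beta.D1BFx.ReducedKernelSandwich (fineHess)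
open Summit.QuantumFields.BalabanUV.Beta.D1BFx.ReducedTableBridge (vertexFamily₂_tableRed')
open Summit.QuantumFields.BalabanUV.Beta.D1BFx.FineStencilBF (ffOf)
open Summit.QuantumFields.BalabanUV.Beta.D1BFx.FineStencilBFBalaban (SbfBal exists_vertexFamily_vertexRed_SbfBal)
open Summit.QuantumFields.BalabanUV.Beta.D1BFx.SecondStencilBF (Wbf biLoc_Wbf)
open Summit.QuantumFields.BalabanUV.Beta.D1BFx.GhostKernelComplete (PghQ fineHessGhQ absMoment₂_PghQ)
open Summit.QuantumFields.BalabanUV.Beta.D1BFx.GluonLeg (Ga)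
open Summit.QuantumFields.BalabanUV.Beta.D1BFx.GluonLegTails (hGa_of_prop12)
open Summit.QuantumFields.BalabanUV.Beta.D1BFx.FrozenLegTails (nOf MOf hn1)
open Summit.QuantumFields.BalabanUV.Beta.D1BFx.FrozenLegProfile (gfrz)
open VectorTailsLoc (fam kfam)
open Summit.QuantumFields.BalabanUV.Beta.D1BFx.RoadEndBFxSpineDictS (d1Rep_BFx_of_D1Tel_dict_sbpS)

namespace Summit.QuantumFields.BalabanUV.Beta.D1BFx.RoadEndBFxDictPointwiseS

/-! ## §1 Generic: the (1.22) second moment of a channel decomposed pointwise -/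

section Generic

variable {υ : Type*} [Fintype υ]

/-- [folklore] Summability of the (1.22) summand of a channel with absolutely summable second moments
(`DecimatedMomentSummable.summable_smul_of_absMoment₂` at the letter `y_μ y_ν`). -/
theorem summable_secondMoment_term {f : Site 4 → ℝ} (hf : AbsMoment₂ f) (μ ν : Fin 4) :
    Summable fun x : Site 4 => f x * (x μ : ℝ) * (x ν : ℝ) := by
  refine (summable_smul_of_absMoment₂ hf (IsMoment₂.coord2 μ ν)).congr fun x => ?_
  rw [zsmul_eq_mul, Int.cast_mul]
  ring

/-- [folklore] **A POINTWISE KERNEL DECOMPOSITION IS READ BY THE (1.22) MOMENT TERM BY TERM.**  If the `(μ, ν)` channel of `T` is, entry by entry,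
`ωA·A μ ν z + ωB·B μ ν z + Σ_u R u μ ν z` and the channels of `A`, `B`, `R u` have absolutely summable second moments, then
`secondMoment T μ ν = ωA·secondMoment A μ ν + ωB·secondMoment B μ ν + Σ_u secondMoment (R u) μ ν`. -/
theorem secondMoment_of_pointwise {T A B : Fin 4 → Fin 4 → Site 4 → ℝ} {R : υ → Fin 4 → Fin 4 → Site 4 → ℝ} {ωA ωB : ℝ} {μ ν : Fin 4}
    (hptw : ∀ z : Site 4, T μ ν z = ωA * A μ ν z + ωB * B μ ν z + ∑ u, R u μ ν z)
    (hA : AbsMoment₂ (A μ ν)) (hB : AbsMoment₂ (B μ ν)) (hR : ∀ u, AbsMoment₂ (R u μ ν)) :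
    B12Beta.secondMoment T μ ν =
      ωA * B12Beta.secondMoment A μ ν + ωB * B12Beta.secondMoment B μ ν + ∑ u, B12Beta.secondMoment (R u) μ ν := by
  classical
  have sA := summable_secondMoment_term hA μ ν
  have sB := summable_secondMoment_term hB μ ν
  have sR : ∀ u, Summable fun x : Site 4 => R u μ ν x * (x μ : ℝ) * (x ν : ℝ) := fun u => summable_secondMoment_term (hR u) μ ν
  have sRs : Summable fun x : Site 4 => ∑ u, R u μ ν x * (x μ : ℝ) * (x ν : ℝ) := summable_sum fun u _ => sR u
  have e : ∀ x : Site 4, T μ ν x * (x μ : ℝ) * (x ν : ℝ) =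
      (ωA * (A μ ν x * (x μ : ℝ) * (x ν : ℝ)) + ωB * (B μ ν x * (x μ : ℝ) * (x ν : ℝ)))
        + ∑ u, R u μ ν x * (x μ : ℝ) * (x ν : ℝ) := by
    intro x
    rw [hptw x]
    simp only [add_mul, Finset.sum_mul]
    ring
  unfold B12Beta.secondMoment
  rw [tsum_congr e, ((sA.mul_left ωA).add (sB.mul_left ωB)).tsum_add sRs, (sA.mul_left ωA).tsum_add (sB.mul_left ωB), tsum_mul_left,
    tsum_mul_left, Summable.tsum_finsetSum (fun u _ => sR u)]

/-- [folklore] **THE `hdict`-SHAPED INEQUALITY FROM A POINTWISE DECOMPOSITION WITH READ-OUT SLACK**: under the hypotheses of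
`secondMoment_of_pointwise` and `|secondMoment (R u) μ ν − Ru u| ≤ CU′ u` for every rest word,
`|secondMoment T μ ν − (ωA·secondMoment A μ ν + ωB·secondMoment B μ ν + Σ_u Ru u)| ≤ Σ_u CU′ u`. -/
theorem abs_secondMoment_sub_le_of_pointwise {T A B : Fin 4 → Fin 4 → Site 4 → ℝ} {R : υ → Fin 4 → Fin 4 → Site 4 → ℝ} {ωA ωB : ℝ}
    {μ ν : Fin 4} (hptw : ∀ z : Site 4, T μ ν z = ωA * A μ ν z + ωB * B μ ν z + ∑ u, R u μ ν z)
    (hA : AbsMoment₂ (A μ ν)) (hB : AbsMoment₂ (B μ ν)) (hR : ∀ u, AbsMoment₂ (R u μ ν)) {Ru CU' : υ → ℝ}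
    (hRu : ∀ u, |B12Beta.secondMoment (R u) μ ν - Ru u| ≤ CU' u) :
    |B12Beta.secondMoment T μ ν - (ωA * B12Beta.secondMoment A μ ν + ωB * B12Beta.secondMoment B μ ν + ∑ u, Ru u)| ≤ ∑ u, CU' u := by
  rw [secondMoment_of_pointwise hptw hA hB hR]
  have e : ωA * B12Beta.secondMoment A μ ν + ωB * B12Beta.secondMoment B μ ν + ∑ u, B12Beta.secondMoment (R u) μ ν
      - (ωA * B12Beta.secondMoment A μ ν + ωB * B12Beta.secondMoment B μ ν + ∑ u, Ru u)
      = ∑ u, (B12Beta.secondMoment (R u) μ ν - Ru u) := by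
    rw [Finset.sum_sub_distrib]; ring
  rw [e]
  exact (Finset.abs_sum_le_sum_abs _ _).trans (Finset.sum_le_sum fun u _ => hRu u)

end Generic

/-! ## §2 The road's `hdict` row from the pointwise dictionary -/

variable {Lc : ℕ} [NeZero Lc] {a N cgh₀ : ℝ} {μ ν : Fin 4} {υ : Type*} [Fintype υ]
  {cE cVH cΛ cR cK cQ cE₂ cJ4 cΛ₂ cR₂ cQ₂ x₀ ωgl ωgh cgh : ℕ → ℝ} {WE WJ WΛ WR WQ : ℕ → TableR} {CE CJ CΛt CRt CQ δW : ℕ → ℝ}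
  {Ru : υ → ℕ → ℝ} {CU : υ → ℝ} {U₁ : ℝ}
  {TΛ WA : ℕ → Fin 4 → Site 4 → Fin 4 → Site 4 → MKer 4 (Fin 4)} {CT δT : ℕ → ℝ}
  {ε : ℕ → ℝ} {X : ℕ → Site 4 → MKer 4 (Fin 4)} {Cx δx : ℕ → ℝ}

omit [NeZero Lc] in
/-- [folklore] One-shot scales are `≥ 2`. -/
theorem two_le_pow_scale (hL : 2 ≤ Lc) {m : ℕ} (hm : 1 ≤ m) : 2 ≤ Lc ^ m :=
  hL.trans (by simpa using Nat.pow_le_pow_right (by omega : 1 ≤ Lc) hm)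

/-- [folklore] **THE GLUON TERM IS A WELL-TYPED (1.22)-KERNEL AT EVERY SCALE, FROM THE END's OWN ROWS**: `Spr (Ga n a)` modulo [B5] Prop. 1.2 ∧
(1.126)–(1.127) BY NAME (`hGa_of_prop12`), the binder-free reduced vertex family of `SbfBal`, and the slot-table sockets `hE hJ hΛ hR hQ` at the common
rate `δW n > 0` (⇒ `tableRed n (Wbf …)` is a second-order vertex family) ⇒ `AbsMoment₂ (TOfRed n a (SbfBal …) (tableRed n (Wbf …)) μ ν)`. -/
theorem absMoment₂_gluon_of_prop12 (ha : 0 < a)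
    (h12 : B5.Prop12Printed (fam nOf hn1 MOf a ha)) (h126 : B5.Kernel126_127Printed (kfam nOf MOf))
    (hδW : ∀ n, 0 < δW n)
    (hE : ∀ n κ u l u', BiLoc (WE n κ u l u') u u' (CE n) (δW n)) (hJ : ∀ n κ u l u', BiLoc (WJ n κ u l u') u u' (CJ n) (δW n))
    (hΛ : ∀ n κ u l u', BiLoc (WΛ n κ u l u') u u' (CΛt n) (δW n)) (hR : ∀ n κ u l u', BiLoc (WR n κ u l u') u u' (CRt n) (δW n))
    (hQ : ∀ n κ u l u', BiLoc (WQ n κ u l u') u u' (CQ n) (δW n))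
    (n : ℕ) [NeZero n] (hn : 2 ≤ n) (μ ν : Fin 4) :
    AbsMoment₂ (TOfRed n a (SbfBal n a (cE n) (cVH n) (cΛ n) (cR n) (cK n) (cQ n))
      (tableRed n (Wbf (cE₂ n) (cJ4 n) (cΛ₂ n) (cR₂ n) (cQ₂ n) (WE n) (WJ n) (WΛ n) (WR n) (WQ n))) μ ν) := by
  obtain ⟨C, δA, hδA, hGa⟩ := hGa_of_prop12 ha h12 h126 n hn
  obtain ⟨Cv, δv, hδv, hV⟩ := exists_vertexFamily_vertexRed_SbfBal n a ha (cE n) (cVH n) (cΛ n) (cR n) (cK n) (cQ n)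
  obtain ⟨Cw2, δ2, hδ2, -, hW⟩ := vertexFamily₂_tableRed' n
    (biLoc_Wbf (cE₂ := cE₂ n) (cJ4 := cJ4 n) (cΛ₂ := cΛ₂ n) (cR₂ := cR₂ n) (cQ₂ := cQ₂ n) (hE n) (hJ n) (hΛ n) (hR n) (hQ n)) (hδW n)
  exact absMoment₂_TOfRed n a (by omega) hGa hδA hV hδv hW hδ2 μ ν

/-- [folklore] **«DICT-PTW»: THE ROAD's (K) ROW `hdict` FROM THE POINTWISE DICTIONARY.**  For composite jet data `Jc`, rest-word KERNELS `Rk u n`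
and, at every one-shot scale `n = Lc^m` (`m ≥ 1`): (i) the POINTWISE identity `hptw` — the `(μ,ν)` channel of the spine's one-shot kernel
`TshotOf Lc Jc m = hessKer (KInv n) (vertexOf (Jc m).S) (Jc m).W` IS `ω_gl n·TOfRed n a (SbfBal …) (tableRed n (Wbf …)) + ω_gh n·PghQ n a x₀ cK cQ + Σ_u Rk u n`
entry by entry; (ii) `AbsMoment₂` of the rest kernels' channel; (iii) the read-out slack `|M₂[Rk u n] − Ru u n| ≤ CU′ u` with `Σ_u CU′ u ≤ U₁` —
together with `0 < a`, the printed tables `h12`∕`h126` and the END's slot-table sockets (which make the gluon and ghost terms well-typed (1.22)-kernels,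
`absMoment₂_gluon_of_prop12`, `absMoment₂_PghQ`) — THE ROW `hdict` of `RoadEndBFxSpineDictS` HOLDS VERBATIM.  HONEST: `hptw` is the (A1)–(A3)
dictionary in pointwise currency — a HYPOTHESIS; nothing of it is discharged here. -/
theorem hdict_of_pointwise (hL : 2 ≤ Lc) (ha : 0 < a)
    (h12 : B5.Prop12Printed (fam nOf hn1 MOf a ha)) (h126 : B5.Kernel126_127Printed (kfam nOf MOf))
    (Jc : ∀ m : ℕ, JetData 3 (Lc ^ m))
    (hδW : ∀ n, 0 < δW n)
    (hE : ∀ n κ u l u', BiLoc (WE n κ u l u') u u' (CE n) (δW n)) (hJ : ∀ n κ u l u', BiLoc (WJ n κ u l u') u u' (CJ n) (δW n))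
    (hΛ : ∀ n κ u l u', BiLoc (WΛ n κ u l u') u u' (CΛt n) (δW n)) (hR : ∀ n κ u l u', BiLoc (WR n κ u l u') u u' (CRt n) (δW n))
    (hQ : ∀ n κ u l u', BiLoc (WQ n κ u l u') u u' (CQ n) (δW n))
    -- THE (K) SLOT IN POINTWISE CURRENCY: rest-word kernels `Rk`, the pointwise dictionary `hptw`, the rest kernels' moments and their read-out slack
    (Rk : υ → ℕ → Fin 4 → Fin 4 → Site 4 → ℝ) {CU' : υ → ℝ}
    (hptw : ∀ m : ℕ, 1 ≤ m → ∀ z : Site 4, TshotOf Lc Jc m μ ν z =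
      ωgl (Lc ^ m) * TOfRed (Lc ^ m) a
          (SbfBal (Lc ^ m) a (cE (Lc ^ m)) (cVH (Lc ^ m)) (cΛ (Lc ^ m)) (cR (Lc ^ m)) (cK (Lc ^ m)) (cQ (Lc ^ m)))
          (tableRed (Lc ^ m) (Wbf (cE₂ (Lc ^ m)) (cJ4 (Lc ^ m)) (cΛ₂ (Lc ^ m)) (cR₂ (Lc ^ m)) (cQ₂ (Lc ^ m))
            (WE (Lc ^ m)) (WJ (Lc ^ m)) (WΛ (Lc ^ m)) (WR (Lc ^ m)) (WQ (Lc ^ m)))) μ ν z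
        + ωgh (Lc ^ m) * PghQ (Lc ^ m) a (x₀ (Lc ^ m)) (cK (Lc ^ m)) (cQ (Lc ^ m)) μ ν z
        + ∑ u, Rk u (Lc ^ m) μ ν z)
    (hMR : ∀ (u : υ) (m : ℕ), 1 ≤ m → AbsMoment₂ (Rk u (Lc ^ m) μ ν))
    (hRu : ∀ (u : υ) (m : ℕ), 1 ≤ m → |B12Beta.secondMoment (Rk u (Lc ^ m)) μ ν - Ru u (Lc ^ m)| ≤ CU' u)
    (hU₁ : ∑ u, CU' u ≤ U₁) :
    ∀ m : ℕ, 1 ≤ m → |B12Beta.secondMoment (TshotOf Lc Jc m) μ ν -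
      (ωgl (Lc ^ m) * B12Beta.secondMoment (TOfRed (Lc ^ m) a
          (SbfBal (Lc ^ m) a (cE (Lc ^ m)) (cVH (Lc ^ m)) (cΛ (Lc ^ m)) (cR (Lc ^ m)) (cK (Lc ^ m)) (cQ (Lc ^ m)))
          (tableRed (Lc ^ m) (Wbf (cE₂ (Lc ^ m)) (cJ4 (Lc ^ m)) (cΛ₂ (Lc ^ m)) (cR₂ (Lc ^ m)) (cQ₂ (Lc ^ m))
            (WE (Lc ^ m)) (WJ (Lc ^ m)) (WΛ (Lc ^ m)) (WR (Lc ^ m)) (WQ (Lc ^ m))))) μ ν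
        + ωgh (Lc ^ m) * B12Beta.secondMoment (PghQ (Lc ^ m) a (x₀ (Lc ^ m)) (cK (Lc ^ m)) (cQ (Lc ^ m))) μ ν
        + ∑ u, Ru u (Lc ^ m))| ≤ U₁ := by
  intro m hm
  have hn : 2 ≤ Lc ^ m := two_le_pow_scale hL hm
  have hA := absMoment₂_gluon_of_prop12 (cE := cE) (cVH := cVH) (cΛ := cΛ) (cR := cR) (cK := cK) (cQ := cQ) (cE₂ := cE₂) (cJ4 := cJ4)
    (cΛ₂ := cΛ₂) (cR₂ := cR₂) (cQ₂ := cQ₂) ha h12 h126 hδW hE hJ hΛ hR hQ (Lc ^ m) hn μ ν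
  have hB : AbsMoment₂ (PghQ (Lc ^ m) a (x₀ (Lc ^ m)) (cK (Lc ^ m)) (cQ (Lc ^ m)) μ ν) :=
    absMoment₂_PghQ (Lc ^ m) a (x₀ (Lc ^ m)) (cK (Lc ^ m)) (cQ (Lc ^ m)) ha μ ν
  exact (abs_secondMoment_sub_le_of_pointwise (hptw m hm) hA hB (fun u => hMR u m hm) (fun u => hRu u m hm)).trans hU₁

/-! ## §3 The junction END over the pointwise dictionary -/

/-- [folklore] **ROAD BF-x ⟹ THE SPINE's `D1Rep` AT THE SPINE ROOT's OWN BINDER NAMES, POINTWISE-DICTIONARY FORM** —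
`RoadEndBFxSpineDictS.d1Rep_BFx_of_D1Tel_dict_sbpS` (p305244) with the (K) row `hdict` REPLACED by the pointwise rows `(Rk) (hptw) (hMR) (hRu) (hU₁)` of
`hdict_of_pointwise`; every other binder BYTE-IDENTICAL (`Js hμν hN hL hodd ha h12 h126 Jc hW hRfl htel · s hs hωs hlam` pins∕ray, sockets, `hdiv`, slot-E∕R∕Λ∕Q
rows, `hU`, `hSL k`).  READING: the road's END for the spine root now displays, about Bałaban's kernels, ONE POINTWISE IDENTITY per one-shot scale
(`hptw`) + unit-class moment rows on named rest kernels — the currency of (A1) `KCombineCovStripped.hessKer_transfer_road_cov_stripped`.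
HONEST: composition BY NAME; 0 rows discharged; (K) NOT closed; NOT D1, NOT `BetaPertH`, NOT continuum, NOT Clay. -/
theorem d1Rep_BFx_of_D1Tel_ptw_sbpS (Js : ℕ → JetData 3 Lc) (hμν : μ ≠ ν) (hN : N ≠ 0) (hL : 2 ≤ Lc) (hodd : Odd Lc)
    (ha : 0 < a)
    (h12 : B5.Prop12Printed (fam nOf hn1 MOf a ha)) (h126 : B5.Kernel126_127Printed (kfam nOf MOf))
    -- bridge B1 REPLACED: composite jet data, the printed symmetries of the flipped step kernels, the spine's `D1Tel`, the one-shot (K)-estimate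
    (Jc : ∀ m : ℕ, JetData 3 (Lc ^ m))
    (hW : ∀ j, WardTransversal (flipK (TbalOf Lc Js j))) (hRfl : ∀ j, AxisReflectionCovariant (flipK (TbalOf Lc Js j)))
    (htel : D1Tel Lc Js Jc)
    -- THE (K) SLOT IN POINTWISE CURRENCY: rest-word kernels `Rk`, the pointwise dictionary `hptw`, the rest kernels' moments and their read-out slack
    (Rk : υ → ℕ → Fin 4 → Fin 4 → Site 4 → ℝ) {CU' : υ → ℝ}
    (hptw : ∀ m : ℕ, 1 ≤ m → ∀ z : Site 4, TshotOf Lc Jc m μ ν z =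
      ωgl (Lc ^ m) * TOfRed (Lc ^ m) a
          (SbfBal (Lc ^ m) a (cE (Lc ^ m)) (cVH (Lc ^ m)) (cΛ (Lc ^ m)) (cR (Lc ^ m)) (cK (Lc ^ m)) (cQ (Lc ^ m)))
          (tableRed (Lc ^ m) (Wbf (cE₂ (Lc ^ m)) (cJ4 (Lc ^ m)) (cΛ₂ (Lc ^ m)) (cR₂ (Lc ^ m)) (cQ₂ (Lc ^ m))
            (WE (Lc ^ m)) (WJ (Lc ^ m)) (WΛ (Lc ^ m)) (WR (Lc ^ m)) (WQ (Lc ^ m)))) μ ν z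
        + ωgh (Lc ^ m) * PghQ (Lc ^ m) a (x₀ (Lc ^ m)) (cK (Lc ^ m)) (cQ (Lc ^ m)) μ ν z
        + ∑ u, Rk u (Lc ^ m) μ ν z)
    (hMR : ∀ (u : υ) (m : ℕ), 1 ≤ m → AbsMoment₂ (Rk u (Lc ^ m) μ ν))
    (hRu : ∀ (u : υ) (m : ℕ), 1 ≤ m → |B12Beta.secondMoment (Rk u (Lc ^ m)) μ ν - Ru u (Lc ^ m)| ≤ CU' u)
    (hU₁ : ∑ u, CU' u ≤ U₁)
    -- the RESCALED loop-weight tie of reading (ii): displayed scalar family `s`, pinned `s n = n⁻²`; the normalisation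
    (s : ℕ → ℝ) (hs : ∀ n : ℕ, 2 ≤ n → s n = ((n : ℝ) ^ 2)⁻¹) (hωs : ∀ n : ℕ, 2 ≤ n → ωgh n * (s n * cK n) ^ 2 = -2 * (ωgl n * cE n ^ 2))
    (hlam : ∀ n : ℕ, 2 ≤ n → ωgl n * cE n ^ 2 = 2 * N ^ 2 * (n : ℝ) ^ 8)
    -- pins and the ray (the rows' letters)
    (hcE : ∀ n : ℕ, 2 ≤ n → cE n = (n : ℝ) ^ 4) (hRsgn : ∀ n : ℕ, 2 ≤ n → cR n = -cE n) (hJ4 : ∀ n : ℕ, cJ4 n = 0)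
    (hcgh : ∀ n : ℕ, |cgh n| ≤ cgh₀) (hKray : ∀ n : ℕ, cK n = cgh n * (n : ℝ) ^ 2) (hQray : ∀ n : ℕ, cQ n = cgh n * a) (hx : ∀ n : ℕ, x₀ n = -cgh n)
    -- slot-table sockets (the END's), covariance, bond swap; `hdiv` (the ghost Ward rows `hrowgh` are a THEOREM on the ray: discharged inside)
    (hδW : ∀ n, 0 < δW n)
    (hE : ∀ n κ u l u', BiLoc (WE n κ u l u') u u' (CE n) (δW n)) (hJ : ∀ n κ u l u', BiLoc (WJ n κ u l u') u u' (CJ n) (δW n))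
    (hΛ : ∀ n κ u l u', BiLoc (WΛ n κ u l u') u u' (CΛt n) (δW n)) (hR : ∀ n κ u l u', BiLoc (WR n κ u l u') u u' (CRt n) (δW n))
    (hQ : ∀ n κ u l u', BiLoc (WQ n κ u l u') u u' (CQ n) (δW n))
    (hEc : ∀ (n : ℕ) (κ : Fin 4) (u : Site 4) (l : Fin 4) (u' t : Site 4),
      WE n κ (u + (n : ℤ) • t) l (u' + (n : ℤ) • t) = shiftK (-((n : ℤ) • t)) (WE n κ u l u'))
    (hJc : ∀ (n : ℕ) (κ : Fin 4) (u : Site 4) (l : Fin 4) (u' t : Site 4),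
      WJ n κ (u + (n : ℤ) • t) l (u' + (n : ℤ) • t) = shiftK (-((n : ℤ) • t)) (WJ n κ u l u'))
    (hΛc : ∀ (n : ℕ) (κ : Fin 4) (u : Site 4) (l : Fin 4) (u' t : Site 4),
      WΛ n κ (u + (n : ℤ) • t) l (u' + (n : ℤ) • t) = shiftK (-((n : ℤ) • t)) (WΛ n κ u l u'))
    (hRc : ∀ (n : ℕ) (κ : Fin 4) (u : Site 4) (l : Fin 4) (u' t : Site 4),
      WR n κ (u + (n : ℤ) • t) l (u' + (n : ℤ) • t) = shiftK (-((n : ℤ) • t)) (WR n κ u l u'))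
    (hQc : ∀ (n : ℕ) (κ : Fin 4) (u : Site 4) (l : Fin 4) (u' t : Site 4),
      WQ n κ (u + (n : ℤ) • t) l (u' + (n : ℤ) • t) = shiftK (-((n : ℤ) • t)) (WQ n κ u l u'))
    (hEs : ∀ n κ u l u', WE n κ u l u' = WE n l u' κ u) (hJs : ∀ n κ u l u', WJ n κ u l u' = WJ n l u' κ u)
    (hΛs : ∀ n κ u l u', WΛ n κ u l u' = WΛ n l u' κ u) (hRs : ∀ n κ u l u', WR n κ u l u' = WR n l u' κ u)
    (hQs : ∀ n κ u l u', WQ n κ u l u' = WQ n l u' κ u)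
    (hdiv : ∀ n : ℕ, 2 ≤ n → ∀ [NeZero n], ∀ (l' : Fin 4) (u' u : Site 4), ∑ κ' : Fin 4,
      (fineHess n a (SbfBal n a (cE n) (cVH n) (cΛ n) (cR n) (cK n) (cQ n))
          (Wbf (cE₂ n) (cJ4 n) (cΛ₂ n) (cR₂ n) (cQ₂ n) (WE n) (WJ n) (WΛ n) (WR n) (WQ n)) κ' l' (u - Pi.single κ' 1) u'
        - fineHess n a (SbfBal n a (cE n) (cVH n) (cΛ n) (cR n) (cK n) (cQ n))
          (Wbf (cE₂ n) (cJ4 n) (cΛ₂ n) (cR₂ n) (cQ₂ n) (WE n) (WJ n) (WΛ n) (WR n) (WQ n)) κ' l' u u') = 0)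
    -- (LOCAL) slot-E support and units; slot-R envelope and units (the three local ghost bubbles are SUPPLIED under reading (ii))
    {ρE : ℕ} {δ₀ kE : ℝ} (hδ₀ : 0 < δ₀) (hδE : ∀ n, δ₀ ≤ δW n)
    (hsuppE : ∀ n κ u l u', ρE < supNorm (u - u') → WE n κ u l u' = 0)
    (hkE : ∀ n : ℕ, 2 ≤ n → |ωgl n * cE₂ n| * CE n ≤ kE * (n : ℝ) ^ 8)
    {CwR δR : ℕ → ℝ} {θR δ₀R kR : ℝ} (hθR : 0 < θR) (hδR : ∀ n, 0 < δR n) (hδ₀R : 0 < δ₀R) (hδRge : ∀ n : ℕ, δ₀R / n ≤ δR n) (hCwR : ∀ n, 0 ≤ CwR n)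
    (hWRenv : ∀ n κ u l u', BiLoc (WR n κ u l u') u u' (CwR n * Real.exp (-(θR / n) * supNorm (u - u'))) (δR n))
    (hkR : ∀ n : ℕ, 2 ≤ n → |ωgl n * cR₂ n| * CwR n * (n : ℝ) ^ 6 ≤ kR)
    -- (Λ) sockets and zero-momentum data
    (hδT : ∀ n, 0 < δT n)
    (hdec : ∀ n : ℕ, 2 ≤ n → ∀ [NeZero n], ∀ κ u l u', WΛ n κ u l u' =
      (∑ m : Fin 4, OneStepResolventKernel.wsum (onLat n (fun y => lamCoeffOf (KInv (N := n) (d := 3)) n m y l u'))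
          (fun v => onLat n (fun y => TΛ n m y κ u) v))
      + (∑ m : Fin 4, OneStepResolventKernel.wsum (onLat n (fun y => lamCoeffOf (KInv (N := n) (d := 3)) n m y κ u))
          (fun v => onLat n (fun y => TΛ n m y l u') v))
      + WA n κ u l u')
    (hTloc : ∀ (n : ℕ) m y κ u, BiLoc (TΛ n m y κ u) ((n : ℤ) • y) ((n : ℤ) • y) (CT n * Real.exp (-δT n * l1 ((n : ℤ) • y - u))) (δT n))
    (hWAa : ∀ n κ u l u', trK (WA n κ u l u') = -WA n κ u l u') (hWAl : ∀ n κ u l u', Loc (WA n κ u l u'))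
    (hTcov : ∀ (n : ℕ) m y κ u t, TΛ n m (y + t) κ (u + (n : ℤ) • t) = shiftK (-((n : ℤ) • t)) (TΛ n m y κ u))
    (hcΛ : ∀ n : ℕ, 2 ≤ n → cΛ n ≠ 0) (hε : ∀ n : ℕ, ε n = 1 ∨ ε n = -1) (hδx : ∀ n, 0 < δx n) (hX : ∀ n u, BiLoc (X n u) u u (Cx n) (δx n))
    (hW1 : ∀ n : ℕ, 2 ≤ n → ∀ [NeZero n], ∀ u,
      comp (comp (Ga n a) (divV (fun κ v => ε n • SbfBal n a (cE n) (cVH n) (cΛ n) (cR n) (cK n) (cQ n) κ v) u)) (Ga n a) =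
        comp (Ga n a) (X n u) - comp (X n u) (Ga n a))
    (hW2 : ∀ n : ℕ, 2 ≤ n → ∀ [NeZero n], ∀ (m : Fin 4) (u : Site 4),
      divV (fun κ v => (-(ε n * (cΛ₂ n / cΛ n))) • TΛ n m 0 κ v) u = comp (X n u) (ffOf (hessFF n m 0)) - comp (ffOf (hessFF n m 0)) (X n u))
    -- (N) slot Q's SOCKETS (the (A2) readout of `WQ`: a decaying bi-localisation envelope at a BLOCK-scale rate floor and its units line — T₈ ⟸ `NeedleTadpoleRowDecay`)
    {CwQ δQ : ℕ → ℝ} {θQ δ₀Q kQ : ℝ} (hθQ : 0 < θQ) (hδQ : ∀ n, 0 < δQ n) (hδ₀Q : 0 < δ₀Q) (hδQge : ∀ n : ℕ, δ₀Q / n ≤ δQ n) (hCwQ : ∀ n, 0 ≤ CwQ n)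
    (hWQenv : ∀ n κ u l u', BiLoc (WQ n κ u l u') u u' (CwQ n * Real.exp (-(θQ / n) * supNorm (u - u'))) (δQ n))
    (hkQ : ∀ n : ℕ, 2 ≤ n → |ωgl n * cQ₂ n| * CwQ n * (n : ℝ) ^ 6 ≤ kQ)
    -- (U)
    (hU : ∀ n : ℕ, 2 ≤ n → ∀ u, |Ru u n| ≤ CU u)
    -- base-point labels of the free one-shot side (the spine root's `hSL` ∕ `k`); the Literature's window data is discharged at `M := id`, `cc := 1`
    {L : Type*} {SL : Finset L} (hSL : SL.Nonempty) (k : L → Fin 4) :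
    D1Rep Lc Jc N μ ν a SL k :=
  d1Rep_BFx_of_D1Tel_dict_sbpS Js hμν hN hL hodd ha h12 h126 Jc hW hRfl htel
    (hdict_of_pointwise hL ha h12 h126 Jc hδW hE hJ hΛ hR hQ Rk hptw hMR hRu hU₁)
    s hs hωs hlam hcE hRsgn hJ4 hcgh hKray hQray hx hδW hE hJ hΛ hR hQ hEc hJc hΛc hRc hQc hEs hJs hΛs hRs hQs hdiv hδ₀ hδE hsuppE hkE hθR hδR hδ₀R
    hδRge hCwR hWRenv hkR hδT hdec hTloc hWAa hWAl hTcov hcΛ hε hδx hX hW1 hW2 hθQ hδQ hδ₀Q hδQge hCwQ hWQenv hkQ hU hSL k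

end Summit.QuantumFields.BalabanUV.Beta.D1BFx.RoadEndBFxDictPointwiseS

end
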